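import Summits.QuantumFields.YangMills.Theorems.SwapVirialDeficitSectorLaplaceMbDensityComparableProfile
import Summits.QuantumFields.YangMills.Theorems.SwapVirialDeficitSectorLaplaceEndGaussShellInterface
import HarnessLib

/-!
# Route `SwapVirialDeficit` (YangMills): THE CORNER FORMS OF THE TIP∕SHELL COMPARABILITY — g49's `tipCorner_le` sockets, read off the two-point profile lemma
# (cell ym-idea-1, skeleton ➎, `stub_core_tip`, corner disc `|p| < ρ₀`; free-hands support of ⟨stmt-QuantumFields-24197⟩ `SwapVirialDeficit.SwapGluedStiffness`)

On the unit disc `x₀² + y₀² ≤ 1` one has `h(p) = x₀²∕(1+x₀²) + y₀²∕(1+y₀²) ≥ ½(x₀²+y₀²)`, so ✓`mbDensity_hubAt_comparable_profile` (w2 g61) gives, with the SAME explicit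
`R₀ = e·((1+d)·20400L⁴)^{7∕2}·(√(¼(1800L⁶)⁻¹)³)⁻¹·(2·(1800L⁶)²)`:
* ★★ `mbDensity_hubAt_comparable_corner` — one base point: `𝔪(hubAt δ_t 1, ε, p)·(1 + ½|p|²(1+δ_t²)) ≤ R₀·(1+δ_t²)²·𝔪(hubAt δ_s 1, ε, p)` (g49's binder 00:57Z with
  `κc = ½`, `Rc = R₀`, no `δ_s`-gain: average against `((1+δ_s²)⁻¹)²` as in w3 g68's ✓`tipMid_le_shell_of_pointwise′`);
* ★★ `mbDensity_hubAt_comparable_corner_disc` — two base points `p, p′` with `(122689728·δ_r⁻¹ + 44712000·dist p p′)·L⁴ ≤ μ_F∕(2·3|Fol L|)` (✓`norm_gnoBase_sub_le`):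
  `𝔪(hubAt δ_t 1, ε, p)·(1 + ½|p|²(1+δ_t²)) ≤ R₀·(1+δ_t²)²·(1+x₀′²)(1+y₀′²)·𝔪(hubAt δ_s 1, ε, p′)` — the shell's disc oscillation is BUILT IN (no `shell_osc` lemma).
Both keep BOTH terms of the structured floor (`α_uα_v ∝ sin⁴θ` regularises `p → 0`, `c_r` regularises `θ → 0`), so that g49's
`∫_{δ>δ_τ}((1+δ²)⁻¹)²(1+δ²)²∕(1+A(1+δ²)) ≤ π∕(2√A)` and `∫_{|p|<ρ₀}|p|⁻¹ ≤ 8ρ₀` give the `τ^{1∕6}`-rate of the corner.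

HONEST LABEL: corollaries; the (δ_t,p)-integration `tipCorner_le`, the core, and the assembly of `stub_core_tip`, ⟨24197⟩ ∕ ⟨24194⟩ remain OPEN; own crux ⟨22884⟩
`LargeFieldMassRefinementTail` OPEN (blocked-on ⟨19935⟩); the Yang–Mills mass gap is NOT proved; no summit is proved by a line.  THEOREMS ONLY (0 `def`, 0 `sorry`, no instance),
standard axioms.  Width seat ym-line-sfw-p2-w2 g61 (cell ym-idea-1, free hands), `--supports stmt-QuantumFields-24197`.  References: [cite: Luscher1983, §2]; [folklore].
-/

set_option autoImplicit false
set_option synthInstance.maxSize 1024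

noncomputable section

open MeasureTheory Quaternion Set Module
open scoped Quaternion BigOperators ENNReal InnerProductSpace
open Literature.MathematicalPhysics.QuantumLattice
open Literature.MathematicalPhysics.QuantumFieldTheory hiding SU2

namespace Summit.QuantumFields.YangMills.Theorems.SwapVirialDeficit.SectorLaplace

open Summit.QuantumFields.YangMills.Theorems.FemtoTransferGap
open Summit.QuantumFields.YangMills.Theorems.FemtoTransferGap.TT
open Summit.QuantumFields.YangMills.Theorems.VirialFluxGap.RingDeficit
open Summit.QuantumFields.YangMills.Theorems.SwapVirialDeficit.SwapRing
open Summit.QuantumFields.YangMills.Theorems.SwapVirialDeficit.BlowUpRing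

variable {L : ℕ} [NeZero L]

omit [NeZero L] in
/-- On the unit disc the soft-pair letter dominates half the squared radius: `½(x₀² + y₀²) ≤ x₀²∕(1+x₀²) + y₀²∕(1+y₀²)` for `x₀² + y₀² ≤ 1`. [folklore] -/
theorem half_normSq_le_softPair (p : ℝ × ℝ) (hp1 : p.1 ^ 2 + p.2 ^ 2 ≤ 1) :
    1 / 2 * (p.1 ^ 2 + p.2 ^ 2) ≤ p.1 ^ 2 / (1 + p.1 ^ 2) + p.2 ^ 2 / (1 + p.2 ^ 2) := by
  have h1 : p.1 ^ 2 / 2 ≤ p.1 ^ 2 / (1 + p.1 ^ 2) :=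
    div_le_div_of_nonneg_left (sq_nonneg _) (by positivity) (by nlinarith [sq_nonneg p.2])
  have h2 : p.2 ^ 2 / 2 ≤ p.2 ^ 2 / (1 + p.2 ^ 2) :=
    div_le_div_of_nonneg_left (sq_nonneg _) (by positivity) (by nlinarith [sq_nonneg p.1])
  linarith

set_option maxHeartbeats 800000 in
/-- ★★ **THE CORNER COMPARABILITY WITH THE SHELL'S DISC OSCILLATION BUILT IN** (two base points): good `ε`, `1 ≤ δ_r ≤ δ_s, δ_t`, `|p| ≤ 1`, and
`(122689728·δ_r⁻¹ + 44712000·dist p p′)·L⁴ ≤ μ_F∕(2·3|Fol L|)`.  Then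
`𝔪(hubAt δ_t 1, ε, p)·(1 + ½|p|²(1+δ_t²)) ≤ R₀·(1+δ_t²)²·((1+x₀′²)(1+y₀′²))·𝔪(hubAt δ_s 1, ε, p′)`. [cite: Luscher1983, §2] -/
theorem mbDensity_hubAt_comparable_corner_disc {ε : GnoSign L} (hε : GoodSign ε) {δr δs δt : ℝ} (hδr : 1 ≤ δr) (hrs : δr ≤ δs) (hrt : δr ≤ δt)
    (p p' : ℝ × ℝ) (hp1 : p.1 ^ 2 + p.2 ^ 2 ≤ 1)
    (hwin : (122689728 * δr⁻¹ + 44712000 * dist p p') * (L : ℝ) ^ 4 ≤ (2304 * (L : ℝ) ^ 6 * (Fintype.card (Fol L) : ℝ))⁻¹ / (2 * (3 * (Fintype.card (Fol L) : ℝ)))) :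
    mbDensity (L := L) (hubAt δt 1) ε p * (1 + 1 / 2 * (p.1 ^ 2 + p.2 ^ 2) * (1 + δt ^ 2)) ≤
      (Real.exp 1 * ((1 + (finrank ℝ (GnoFol L) : ℝ)) * (20400 * (L : ℝ) ^ 4)) ^ (7 / 2 : ℝ) *
          (Real.sqrt ((1 / 4 : ℝ) * (1 / (1800 * (L : ℝ) ^ 6))) ^ 3)⁻¹ * (2 * (1800 * (L : ℝ) ^ 6) ^ 2)) *
        (1 + δt ^ 2) ^ 2 * ((1 + p'.1 ^ 2) * (1 + p'.2 ^ 2)) * mbDensity (L := L) (hubAt δs 1) ε p' := by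
  have hL : (0 : ℝ) < (L : ℝ) := Nat.cast_pos.2 (Nat.pos_of_ne_zero (NeZero.ne L))
  -- the joint window in the `GnoCoord` norm
  have hwin' : (122689728 * δr⁻¹ + 44712000 * ‖(gnoBase p.1 p.2 : GnoCoord L) - gnoBase p'.1 p'.2‖) * (L : ℝ) ^ 4 ≤
      (2304 * (L : ℝ) ^ 6 * (Fintype.card (Fol L) : ℝ))⁻¹ / (2 * (3 * (Fintype.card (Fol L) : ℝ))) := by
    refine le_trans ?_ hwin
    have h := norm_gnoBase_sub_le (L := L) p p'
    gcongr
  have h := mbDensity_hubAt_comparable_profile hε hδr hrs hrt p p' hwin'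
  set R₀ : ℝ := Real.exp 1 * ((1 + (finrank ℝ (GnoFol L) : ℝ)) * (20400 * (L : ℝ) ^ 4)) ^ (7 / 2 : ℝ) *
      (Real.sqrt ((1 / 4 : ℝ) * (1 / (1800 * (L : ℝ) ^ 6))) ^ 3)⁻¹ * (2 * (1800 * (L : ℝ) ^ 6) ^ 2) with hR₀
  set H : ℝ := p.1 ^ 2 / (1 + p.1 ^ 2) + p.2 ^ 2 / (1 + p.2 ^ 2) with hH
  set A : ℝ := 1 + δt ^ 2 with hA
  set J : ℝ := (1 + p.1 ^ 2) * (1 + p.2 ^ 2) with hJ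
  set J' : ℝ := (1 + p'.1 ^ 2) * (1 + p'.2 ^ 2) with hJ'
  set mt : ℝ := mbDensity (L := L) (hubAt δt 1) ε p with hmt
  set ms : ℝ := mbDensity (L := L) (hubAt δs 1) ε p' with hms
  have hd9 := nine_le_finrank_gnoFol (L := L)
  have hR0 : 0 ≤ R₀ := by
    rw [hR₀]
    have : 0 ≤ ((1 + (finrank ℝ (GnoFol L) : ℝ)) * (20400 * (L : ℝ) ^ 4)) ^ (7 / 2 : ℝ) := Real.rpow_nonneg (by positivity) _
    positivity
  have hH0 : 0 ≤ H := by rw [hH]; positivity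
  have hA0 : 0 < A := by rw [hA]; positivity
  have hJ1 : 1 ≤ J := by rw [hJ]; nlinarith [sq_nonneg p.1, sq_nonneg p.2, mul_nonneg (sq_nonneg p.1) (sq_nonneg p.2)]
  have hJ'0 : 0 ≤ J' := by rw [hJ']; positivity
  have hmt0 : 0 ≤ mt := mbDensity_nonneg _ _ _
  have hms0 : 0 ≤ ms := mbDensity_nonneg _ _ _
  have hHge : 1 / 2 * (p.1 ^ 2 + p.2 ^ 2) ≤ H := by rw [hH]; exact half_normSq_le_softPair p hp1
  have hB0 : 0 < 1 + H * A := by positivity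
  have h' : mt ≤ R₀ * (A ^ 2 / (1 + H * A)) * (J' / J) * ms := h
  calc mt * (1 + 1 / 2 * (p.1 ^ 2 + p.2 ^ 2) * A) ≤ mt * (1 + H * A) := by
        refine mul_le_mul_of_nonneg_left ?_ hmt0
        nlinarith [mul_le_mul_of_nonneg_right hHge hA0.le]
    _ ≤ R₀ * (A ^ 2 / (1 + H * A)) * (J' / J) * ms * (1 + H * A) := mul_le_mul_of_nonneg_right h' hB0.le
    _ = R₀ * A ^ 2 * (J' / J) * ms := by field_simp
    _ ≤ R₀ * A ^ 2 * J' * ms := by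
        have hJJ : J' / J ≤ J' := div_le_self hJ'0 hJ1
        gcongr

/-- ★★ **THE CORNER COMPARABILITY AT ONE BASE POINT** (g49's binder, `κc = ½`, `Rc = R₀`, no `δ_s`-gain): good `ε`, `1 ≤ δ_r ≤ δ_s, δ_t` in the hub matching window
`122689728·δ_r⁻¹·L⁴ ≤ μ_F∕(2·3|Fol L|)`, `|p| ≤ 1`: `𝔪(hubAt δ_t 1, ε, p)·(1 + ½|p|²(1+δ_t²)) ≤ R₀·(1+δ_t²)²·𝔪(hubAt δ_s 1, ε, p)`. [cite: Luscher1983, §2] -/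
theorem mbDensity_hubAt_comparable_corner {ε : GnoSign L} (hε : GoodSign ε) {δr δs δt : ℝ} (hδr : 1 ≤ δr) (hrs : δr ≤ δs) (hrt : δr ≤ δt)
    (hwin : 122689728 * δr⁻¹ * (L : ℝ) ^ 4 ≤ (2304 * (L : ℝ) ^ 6 * (Fintype.card (Fol L) : ℝ))⁻¹ / (2 * (3 * (Fintype.card (Fol L) : ℝ))))
    (p : ℝ × ℝ) (hp1 : p.1 ^ 2 + p.2 ^ 2 ≤ 1) :
    mbDensity (L := L) (hubAt δt 1) ε p * (1 + 1 / 2 * (p.1 ^ 2 + p.2 ^ 2) * (1 + δt ^ 2)) ≤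
      (Real.exp 1 * ((1 + (finrank ℝ (GnoFol L) : ℝ)) * (20400 * (L : ℝ) ^ 4)) ^ (7 / 2 : ℝ) *
          (Real.sqrt ((1 / 4 : ℝ) * (1 / (1800 * (L : ℝ) ^ 6))) ^ 3)⁻¹ * (2 * (1800 * (L : ℝ) ^ 6) ^ 2)) *
        (1 + δt ^ 2) ^ 2 * mbDensity (L := L) (hubAt δs 1) ε p := by
  have hL : (0 : ℝ) < (L : ℝ) := Nat.cast_pos.2 (Nat.pos_of_ne_zero (NeZero.ne L))
  have hwin' : (122689728 * δr⁻¹ + 44712000 * ‖(gnoBase p.1 p.2 : GnoCoord L) - gnoBase p.1 p.2‖) * (L : ℝ) ^ 4 ≤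
      (2304 * (L : ℝ) ^ 6 * (Fintype.card (Fol L) : ℝ))⁻¹ / (2 * (3 * (Fintype.card (Fol L) : ℝ))) := by
    rw [sub_self, norm_zero, mul_zero, add_zero]; exact hwin
  have h := mbDensity_hubAt_comparable_profile hε hδr hrs hrt p p hwin'
  set R₀ : ℝ := Real.exp 1 * ((1 + (finrank ℝ (GnoFol L) : ℝ)) * (20400 * (L : ℝ) ^ 4)) ^ (7 / 2 : ℝ) *
      (Real.sqrt ((1 / 4 : ℝ) * (1 / (1800 * (L : ℝ) ^ 6))) ^ 3)⁻¹ * (2 * (1800 * (L : ℝ) ^ 6) ^ 2) with hR₀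
  set H : ℝ := p.1 ^ 2 / (1 + p.1 ^ 2) + p.2 ^ 2 / (1 + p.2 ^ 2) with hH
  set A : ℝ := 1 + δt ^ 2 with hA
  set J : ℝ := (1 + p.1 ^ 2) * (1 + p.2 ^ 2) with hJ
  set mt : ℝ := mbDensity (L := L) (hubAt δt 1) ε p with hmt
  set ms : ℝ := mbDensity (L := L) (hubAt δs 1) ε p with hms
  have hd9 := nine_le_finrank_gnoFol (L := L)
  have hR0 : 0 ≤ R₀ := by
    rw [hR₀]
    have : 0 ≤ ((1 + (finrank ℝ (GnoFol L) : ℝ)) * (20400 * (L : ℝ) ^ 4)) ^ (7 / 2 : ℝ) := Real.rpow_nonneg (by positivity) _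
    positivity
  have hH0 : 0 ≤ H := by rw [hH]; positivity
  have hA0 : 0 < A := by rw [hA]; positivity
  have hJ0 : 0 < J := by rw [hJ]; positivity
  have hmt0 : 0 ≤ mt := mbDensity_nonneg _ _ _
  have hms0 : 0 ≤ ms := mbDensity_nonneg _ _ _
  have hHge : 1 / 2 * (p.1 ^ 2 + p.2 ^ 2) ≤ H := by rw [hH]; exact half_normSq_le_softPair p hp1
  have hB0 : 0 < 1 + H * A := by positivity
  have h' : mt ≤ R₀ * (A ^ 2 / (1 + H * A)) * (J / J) * ms := h
  rw [div_self hJ0.ne', mul_one] at h'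
  calc mt * (1 + 1 / 2 * (p.1 ^ 2 + p.2 ^ 2) * A) ≤ mt * (1 + H * A) := by
        refine mul_le_mul_of_nonneg_left ?_ hmt0
        nlinarith [mul_le_mul_of_nonneg_right hHge hA0.le]
    _ ≤ R₀ * (A ^ 2 / (1 + H * A)) * ms * (1 + H * A) := mul_le_mul_of_nonneg_right h' hB0.le
    _ = R₀ * A ^ 2 * ms := by field_simp

end Summit.QuantumFields.YangMills.Theorems.SwapVirialDeficit.SectorLaplace

end
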